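import Literature.MathematicalPhysics.QuantumFieldTheory.Balaban1983to89.B12Momentum511
import Literature.MathematicalPhysics.QuantumFieldTheory.Balaban1983to89.Beta.PolarizationSign

/-!
# `Balaban1983to89.B12Carve25Sect5TensorHyp` — [Balaban1987RG1] Sect. 5, part 1, pp. 292–296 [PDF 44–48] («5. The Analysis
# of the Vacuum Polarization Tensor and the β-Functions», (5.1)–(5.35)): THE HYPOTHESIS-FORM BUNDLE OF CARVING BLOCK 25, keyed
# to the position-space kernel currency `B12Beta.Kernel d` of the [B12] lineage and of NODE 00 (`B12Sec2to5.Decay510`,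
# `B12Beta.PermCovariant`, `B12Transverse536.ReflCovariant ∕ WardFirst`, `Beta.PolarizationSign.IndexSymmetric`)

statement-level skeleton of published theorems with citation tags; proofs where landed; nothing here is a claim about the
Yang–Mills mass gap

SOURCE.  T. Bałaban, *Renormalization group approach to lattice gauge field theories. I. Generation of effective actions in a
small field approximation and a coupling constant renormalization in four dimensions*, Commun. Math. Phys. **109** (1987)
249–301, doi:10.1007/bf01215223 [`Balaban1987RG1`] (cell paper "B12" = [I] of the small-field pair [I]∕[II]; held
`paper:balaban1987-cmp109-rg-i-small-field`, journal page = PDF page + 248).  Pages 292–296 were read first-hand for this file AS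
IMAGES on the page renders `run/shared/lean/pub/pub-balaban/b2b-balaban-ref1/pages/1987-cmp109-rg-I-small-field/…-p044-x2.png …
-p048-x2.png` AND on the text layer (`lit read … --pages 43-49`, files p0044.txt–p0048.txt; line numbers «p00NN.txt:Lk» below are
text-layer lines; displays garbled there, read on the renders).  STATUS of the source: published, refereed; the series' end
statement is a CLAIM UNDER ADJUDICATION by the audit cell `pub-balaban`.

WHY THIS FILE (cell `lit-balaban`, P6 CARVING FAN of D-0154 (3b); seat `lit-balaban-carve-09` g3 — third block of the seat after
blocks 40 and 35, taken under the cell lead's RULING #8 (`run/shared/lean/pub/lit-balaban/carve/STATUS.md` 2026-08-28T07:30:58Z: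
«a 31–40 carver after its block is LANDED + refereed takes the highest UNCLAIMED of 30, 29, 28 …»; CLAIM line 2026-08-28T08:09:19Z,
the lead seat closed 07:55:37Z so the rulings run themselves); block row 25 of `carve/BLOCKS-21-30.md` = `carve/CARVE-LIST.md` § Block
25, rules `carve/CARVE-RULES.md`; KEY item `stmt-QuantumFields-20543` (K2⁷ `EndpointGivenBR13SepCoPH`, the [B12]∕[B13] node),
also-feeds `stmt-QuantumFields-20544`).  The block is Sect. 5 up to (5.35): the definition (5.1) of the vacuum polarization tensor as
an infinite-volume limit, its Euclidean covariance (5.2)–(5.8), the Ward identity (5.9), the exponential decay (5.10), the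
momentum representation and the analytic strip (5.11)–(5.15), the goal (5.16), and the Laurent-splitting road (5.17)–(5.35) towards
(5.16).  At statement level this stretch is IN THE TREE, densely (CARVE-LIST § Block 25: 14 SKELETON rows — 8 proved-existing, 5
proved, 1 «absent» whose locus is pp. 297–301 = block 26; 838 in-tree declarations in 118 files cite a locator in the range; the
[B12] §5 lineage `B12Covariance54 ∕ B12Transl58 ∕ B12EuclCov567 ∕ B12Ward59 ∕ B12GaugeInv47 ∕ B12Decay510* ∕ B12Momentum511 ∕
B12Rep526* ∕ B12LaurentSplit522* ∕ B12Taylor530 ∕ B12Eq531Symmetry ∕ B12Sec5Algebra ∕ B12Rep537 ∕ B12Transverse536` PROVES the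
section's algebra and analysis display by display, with three located print slips) — so, by the fan's rule «IN TREE = CITE, NEVER
RESTATE» (CARVE-RULES §2.3), this file (a) RESTATES NOTHING: every printed statement of the block that has a declaration is cited
BY NAME below (table + census); (b) finds, after a sentence-by-sentence census of pp. 292–296 against the tree, NO printed statement
of the block without an in-tree home — the block's residual is EMPTY (CARVE-LIST § Block 25: «RESIDUAL candidates: none by display
label (23 labels seen)»; its two claim cues p.292:L14 ∕ p.292:L29 are located below); (c) conjoins, BY NAME and over the currency the
consumer side reads them in, the section's STANDING PROPERTIES of the tensor — p. 293 after (5.15): *«We will analyze this function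
using the above properties only»* — into ONE hypothesis bundle `Hyp` over a FAMILY of kernels `P i : B12Beta.Kernel d` (one per
step ∕ coupling history: p. 298 *«In fact we should write the superscript (j) at the tensor»*; the printed constants «O(1)E₀», «δ₁
determined by δ₀, κ, and M» are uniform, so `C`, `δ₁` sit BEFORE the family index): (5.10) `B12Sec2to5.Decay510`, (5.6)
`B12Beta.PermCovariant`, (5.7) `B12Transverse536.ReflCovariant`, (5.8) `Beta.PolarizationSign.IndexSymmetric` (translation
invariance (5.8)₁ is the TYPE `B12Beta.Kernel`), (5.9) `B12Transverse536.WardFirst` — with the kernel-checked bookkeeping the tree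
performs on them: the section's GOAL (5.16) in its second-order content (`Hyp.taylorData3`, by `B12Transverse536.taylorData3_of_
symmetries` — *«Our goal is to prove a representation of the form (4.41), more exactly of the form (5.16) … and to find the
coefficient β»*, β = the second moment (1.22)), the analytic strip of (5.11) (`Hyp.analytic511`), (5.12), (5.13), (5.26)
(`Hyp.eq512 ∕ eq513 ∕ eq526`), and the uniform absolute bound of the second moments that (5.10) yields (`Hyp.secondMoment_abs_le`).

## The block's SKELETON rows → the in-tree declarations this file CITES (never restates)

(module prefix `…Balaban1983to89.` dropped; «H» = hypothesis-form `Prop`, «T» = theorem, «D» = definition∕structure, «M» = module)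

| row | print | in tree | used here |
|---|---|---|---|
| B12.§5beta | «Sect. 5 β-function properties» (CARVE-LIST locus pp. 294–301) | D `Dag.Leaves` (field `betaPositive`, the DAG's abstract leaf); D `B12BetaAsPrinted.Setting ∕ Conclusions ∕ B12BetaAsPrinted` (Thm 3 with §5); H `B12StepObligation.Beta542Source`, `B12BetaHolo.PiHoloSource` | NOTHING of it is printed on pp. 292–296: the β-function enters this block only in the goal sentence p. 293 [p0045.txt:L34] *«and to find the coefficient β»* and in the coefficients β_{μν} of (5.34)–(5.35) p. 296 (row B12.Eq5.33-5.35); its definition (5.39)∕(5.42), bounds (5.44) and properties pp. 297–301 are BLOCK 26 (`B12Carve26Sect5BetaHyp`) — cited, not typed |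
| B12.Eq5.1 | (5.1) p. 292, *«Π(b, b′) = lim_{T₁^{(j)}↗Z⁴} δ²∕δB(b)δB(b′) 𝐄^{(j)}(U_j(exp iB))∣_{B=0}»* | T `B12Covariance54.iteratedFDeriv_two_invariant`, `hessian_invariant` ((5.1)–(5.4)); D `Node00.polLimit` (the tree's total limit of record), `Beta.RemainderLimitTorus.limKernel`, `B12PolarizationTensor120` ((1.20)–(1.21)); T `B12Decay510.decay510_of_tendsto ∕ decay510_of_family` ((5.1) with (5.10)), `B12Decay510Torus.decay510_torus`; M `B12EuclCov567` (`cov567_of_limit`, `symmetries_of_limit_of_invariance`: the limit kernel inherits (5.6)–(5.8)) | the family `P i` of `Hyp` IS such a limit kernel per step; cited |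
| B12.Eq5.2-5.4 | (5.2)–(5.4) p. 292 (invariance of 𝐄^{(j)}(U_j(exp iB)) under Euclidean r; (5.3) (rU)(b) = U(r⁻¹b); (5.4) Π(rb, rb′) = Π(b, b′)) | D `B12Covariance54.pull ∕ permAct ∕ reflAct ∕ transAct` ((5.3)), T `form_permAct ∕ form_reflAct` ((5.4)); T `B12EuclCov567.hessian_perm_pi ∕ hessian_refl_pi ∕ cov567_finiteVolume` ((5.2)⇒(5.4)); T `B12PolarizationTensor120.polTensor_translate ∕ polTensor_perm` | inputs of the dischargers of `Hyp.perm ∕ refl ∕ symm`; cited |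
| B12.Eq5.5-5.8 | (5.5) Π_{μν}(x, y); (5.6) permutations; (5.7) reflections; (5.8) translation invariance + symmetry | D `B12Covariance54.obval` ((5.5), with *«Π(−b, b′) = −Π(b, b′)»*), `permK ∕ reflTwK ∕ swapK`, T `permK_eq_iff_printed ∕ reflTwK_eq_iff ∕ permCovariant_iff ∕ reflCovariant_iff` (the printed two-point forms ⇔ the typed predicates); H `B12Beta.PermCovariant` ((5.6), typed at (1.21)), H `B12Transverse536.ReflCovariant` ((5.7)), H `Beta.PolarizationSign.IndexSymmetric` ((5.8)₂; also `AxisReflectionCovariant`), T `B12Transl58.swap_kernel` ((5.8)₂ from translation invariance + symmetry), M `B12EuclCov567` | fields `Hyp.perm`, `Hyp.refl`, `Hyp.symm` |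
| B12.Eq5.9 | (5.9) p. 293, *«The gauge invariance, expressed in the first identity (4.15), implies Σ_μ ∂*_μΠ_{μν}(x − y) = Σ_ν ∂_νΠ_{μν}(x − y) = 0»* | H `B12Transverse536.WardFirst` (also `WardB`, `Beta.PolarizationSign.WardTransversal`); T `B12GaugeInv47.eq59_of_limit_of_gaugeInvariance47` ((4.15)₁ ⇒ (5.9) for the limit kernel), M `B12Ward59`, `B12Ward414`; T `B12Covariance54.form_grad_left` | field `Hyp.ward`; `Hyp.wardTransversal` |
| B12.Eq5.10 | (5.10) p. 293 with *«a positive constant δ₁ determined by δ₀, κ, and M (e.g., δ₁ = ½min{δ₀, κM⁻¹})»* | H `B12Sec2to5.Decay510`; D `B12Decay510.delta1` + T `delta1_pos` (the printed example value), T `B12Decay510.decay510_of_leaves ∕ decay510_of_analytic_leaves ∕ abs_twoPoint_le_of_repr435` (*«The representation (4.37) yields»* — from the inductive bound and the polymer sum; cell GAPS G-B12s-15), M `B12Decay510FromB11 ∕ B12Decay510R1 ∕ B12Decay510Lattice ∕ B12Decay510Window ∕ B12Decay510Torus`; H `Node00.U3OfKernels.KernelDecay ∕ KernelDecayOfRecord₁₃`,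 `Node00.U3KernelLetters.WindowedDecay` (NODE 00's (5.10)-class clauses) | fields `Hyp.δ₁_pos`, `Hyp.decay`; `Hyp.expBound`, `Hyp.momentSummable`, `Hyp.secondMoment_abs_le` |
| B12.Eq5.11 | (5.11) p. 293 + periodicity + *«By the inequality (5.10) it can be extended as an analytic function to complex variables ζ_μ = p_μ + iq_μ, ∣q_μ∣ < δ₁»* | D `B12Momentum511.piT ∕ PolyStrip ∕ ClosedPolyStrip`, T `piT_periodic`, `analyticOnNhd_piT_of_decay510`, `latticeKernel_piT_of_decay510` (Fourier inversion), `summable_piT`; T `B12Rep537.genFun_fdelta` | `Hyp.analytic511` |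
| B12.Eq5.12-5.15 | (5.12)–(5.15) p. 293 (*«where ∂_μ(ζ) = e^{iζ_μ} − 1»*) | T `B12Momentum511.eq512 ∕ eq513 ∕ eq513_of_reflCovariant ∕ eq514 ∕ eq515_left ∕ eq515_right`, D `dSym`; D `B12Rep526Coeff.Perm512 ∕ Sym514 ∕ flipU`, T `perm512_of_permCovariant`; D `B12Rep537.fdelta`, H `B12Transverse536.ReflCovariant` ((5.7)∕(5.13)) | `Hyp.eq512`, `Hyp.eq513` |
| B12.Eq5.16 | (5.16) p. 293, the GOAL *«Π_{μν}(p) = β(δ_{μν}Δ(p) − ∂̄_μ(p)∂_ν(p)) + (terms of higher orders in derivatives ∂(p), ∂̄(p))»* | D `B12Rep537.wilsonQ ∕ TaylorData3` (its second-order content on the coefficient side), T `B12Transverse536.taylorData3_of_symmetries` ((5.6)+(5.7)+(5.9)₁+(5.10) ⇒ (5.16)'s second-order data with β = (1.22)), `B12Sec5Algebra.transverse_jet ∕ transverse_of_ward` (the jet-algebra route) | ★ `Hyp.taylorData3` |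
| B12.Eq5.17-5.21 | (5.17)–(5.21) p. 294 (f_{μν} on the polyring; *«The functions f_{μν}(z) are analytic on the polyring»*) | D `B12Rep526Coeff.f529`, `B12Momentum511.expI`, `B12Rep526Analytic.OpenPolyAnnulus`, T `B12Rep526Analytic.analyticOnNhd_f529`, `B12Momentum511.piT_eq_f529`; D `B12Rep526.sgn ∕ twist ∕ permZ`, T `B12Rep526Coeff.eq518 ∕ cov519_of_reflCovariant ∕ eq520`, `B12Rep526.eq519_of_rep526 ∕ key_mu ∕ key_nu`; (5.21): D `B12Transverse536.WardB`, `B12WardLeadingForm.WardB₂` | cited |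
| B12.Eq5.22-5.26 | p. 294 l. 16–29 (the one-variable splitting f = g⁺(z) + g⁻(z⁻¹), *«unique up to an additive constant … normalization conditions»*, the three cases) and (5.22)–(5.26) | T `B12LaurentSplit522.laurent_split ∕ laurent_unique_const ∕ law_S ∕ law_M ∕ law_N`, D `gPlus ∕ gMinus`; T `B12LaurentSplitting522Proof.laurent_splitting ∕ laurent_splitting_unique ∕ splitting_caseS ∕ caseM ∕ caseN`, M `B12LaurentSplit522Bridge`; D `B12Rep526Coeff.Role ∕ role ∕ wgt ∕ piece ∕ gRep ∕ PolyDisc ∕ reindex525`, T `eq522 ∕ eq523 ∕ eq524_mu ∕ eq524_nu ∕ eq525 ∕ eq526 ∕ eq526_of_reflCovariant`; D `B12Rep526.rep526 ∕ gEps ∕ low`; T `B12Rep526Unique.rep526_unique` (+ `InOrth`, `asm`); T `B12Rep526Analytic.analyticOnNhd_piece ∕ analyticOnNhd_gRep` (*«analytic on the polydisc»*); D `B12Sec5Algebra.opS ∕ opM ∕ opN ∕ F11 ∕ F12 ∕ F21` | `Hyp.eq526` |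
| B12.Eq5.27-5.29 | (5.27)–(5.29) p. 295 (+ *«all these terms, and in particular the function g_{μν}(z), are real functions for real variables z»*) | D `B12Eq531Symmetry.Cov527`, T `B12Rep526Coeff.eq527 ∕ eq528 ∕ eq529_restricted ∕ f529_eq_genFun ∕ piece_im_eq_zero ∕ gRep_im_eq_zero`, `B12Rep526Unique.rep526_perm ∕ eq527_of_eq518 ∕ eq528_of_eq520`, `B12Rep526.eq518_of_eq527 ∕ eq520_of_eq528`, `B12Sec5Algebra.f12_eq_f21_inv` | cited |
| B12.Eq5.30-5.32 | (5.30) p. 295 (+ *«The coefficients a, b and the functions g above are real for real values of z, the functions are analytic on the polydisc»*), (5.31), (5.32) p. 296 (+ *«all the coefficients a_{μν,κ} with three different indices are equal, similarly all the coefficients a_{μμ,ν} with μ ≠ ν are equal, and so on. The same conclusions hold for b_{μν,κλ}»*) | T `B12Taylor530.eq530 ∕ eq530_gRep ∕ analyticOnNhd_rem530 ∕ im_coeffA_gRep_eq_zero ∕ im_coeffB_gRep_eq_zero ∕ im_rem530_gRep_eq_zero`, D `rem530 ∕ cubic`; D `B12Sec5Algebra.T2 ∕ taylor₂`; D `B12Eq531Symmetry.coeffA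 ∕ coeffB`, T `eq531 ∕ eq531_order2 ∕ eq531_order3 ∕ eq532_a ∕ eq532_b ∕ coeffA_eq_of_distinct ∕ coeffA_mixed_eq ∕ coeffA_diag_eq ∕ coeffB_eq_of_perm` | cited |
| B12.Eq5.33-5.35 | (5.33)–(5.35) p. 296 with the comments (f_{μν}(1) = δ_{μν}2^d g_{μμ}(1); f_{μμ}(1) = 0 hence g_{μμ}(1) = 0; *«the whole term in the first line … is equal to 0»*; *«We multiply (5.33) by z_ν − 1, sum over ν … third order terms only»*; (5.34); *«Denoting the left-hand side of these equations by −β_{μν}»*; *«all the coefficients β_{μν} for μ ≠ ν are equal»*) | D `B12Sec5Algebra.R11 ∕ R12 ∕ printed533diag ∕ um ∕ jetQ`, T `eq533_offdiag ∕ eq533_diag ∕ F11_quad ∕ F12_quad ∕ ward534 ∕ eq535_diag_coeff ∕ eq536_11 ∕ eq536_12 ∕ gdiag_axis_vanishes ∕ vanish_of_odd_under_inversion ∕ transverse_of_ward`; in the (1.22) currency T `B12Beta.secondMoment_pair_indep` (*«all β_{μν}, μ ≠ ν, equal»* under (5.6)) | `Hyp.secondMoment_pair_indep`; cited |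

## Census of the REMAINING printed statements of pp. 292–296 (every sentence that asserts something, page by page)

* p. 292 l. 1–11 [p0044.txt:L1–L11] ((4.45) and *«hence this term vanishes … hence both groups of terms cancel, because (4.38) appears
  with the minus sign in the effective action (1.6)»*; *«In the next section we will prove that the polarization tensor Π has a
  similar structure as the operator Δ_j … We define the β-function β_j(g_{j−1}) equal to this coefficient»*) — Sect. 4, block 24
  (`B12Moments443.M1x`, `B12Eq442DeltaJ.cancel292_form_of_symmetries`, `Beta.MarginalTelescoping.IdentityForm ∕ SeparationRate`
  (p. 292 l. 2–9), `B12Marginal444`); the announcement is the programme of rows B12.Eq5.16 ∕ B12.§5beta: cited.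
* p. 292 l. 13–14 [L13–L14] (CARVE-LIST cue p.292:L14) *«The vacuum polarization tensor is defined by the formula (4.37) of the previous
  section. From this it follows that it can be defined also as (5.1)»* — row B12.Eq5.1 (the equality of the (4.37)-object with the
  (5.1)-limit is the tree's `Node00.polLimit` ∕ `Beta.RemainderLimitTorus.limKernel ∕ PolLeavesTLoc` reading; `B12Decay510.
  decay510_of_tendsto`): cited.
* p. 292 l. 15–21 [L15–L21] (*«This representation is basic for the further analysis, because it implies symmetries of the tensor. The
  function 𝐄^{(j)}(U_j(exp iB)) is invariant with respect to all Euclidean symmetries r of the lattice T₁^{(j)}»*, (5.2), (5.3), *«The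
  invariance (5.2) yields the following covariant transformation law»* (5.4)) — rows B12.Eq5.2-5.4: cited (the invariance is an
  INPUT of §5 — [I] (1.19)∕(2.15) gauge and Euclidean invariance of the effective actions, `B12StepObligation.SpacesGaugeInvariant`,
  `Step.SFNewTerm.gaugeInv119`; the implication (5.2) ⇒ (5.4) is `B12Covariance54.iteratedFDeriv_two_invariant`).
* p. 292 l. 24–25 [L24–L25] (*«where Π is extended to negatively oriented bonds by the equality Π(−b, b′) = −Π(b, b′), similarly for the
  second argument»*) — `B12Covariance54.obval` (the odd extension, definitional): cited.
* p. 292 l. 25–31 [L25–L31] (CARVE-LIST cue p.292:L29) (*«We would like to get the representation (4.41) for the function (5.5).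
  Unfortunately the Euclidean covariance (5.4) takes on a more complicated form for this function. We formulate it explicitly in two
  special cases, which we will use in the sequel»*, (5.6)) — programme + row B12.Eq5.5-5.8: cited; no separate statement.
* p. 293 l. 1–11 [p0045.txt:L2–L11] ((5.7) with its derivation sentence, (5.8) *«The function Π is also translation invariant and
  symmetric, hence»*, (5.9)) — rows B12.Eq5.5-5.8, B12.Eq5.9: cited; `Hyp.refl ∕ symm ∕ ward`.
* p. 293 l. 12–15 [L12–L15] ((5.10) and its constants clause) — row B12.Eq5.10: cited; `Hyp.decay`, `Hyp.δ₁_pos` (the clause *«δ₁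
  determined by δ₀, κ, and M (e.g., δ₁ = ½min{δ₀, κM⁻¹})»* = `B12Decay510.delta1`, a bodied definition with `delta1_pos`).
* p. 293 l. 15–23 [L15–L23] ((5.11); *«the integration over p with components p_μ satisfying ∣p_μ∣ ≦ π. The function Π_{μν}(p) is
  periodic in variables p_μ, with the period 2π. By the inequality (5.10) it can be extended as an analytic function to complex
  variables ζ_μ = p_μ + iq_μ, ∣q_μ∣ < δ₁. This property is the basic reason why we have taken the infinite volume limit in (5.1)»*) —
  row B12.Eq5.11: cited (`piT_periodic` unconditional; analyticity `analyticOnNhd_piT_of_decay510`); `Hyp.analytic511`; the last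
  sentence is a remark.
* p. 293 l. 23–29 [L23–L29] ((5.12)–(5.15) *«for the function Π_{μν}(ζ)»*, *«where ∂_μ(ζ) = e^{iζ_μ} − 1»*) — row B12.Eq5.12-5.15: cited;
  `Hyp.eq512 ∕ eq513`.
* p. 293 l. 30–36 [L30–L36] (*«We will analyze this function using the above properties only. Our goal is to prove a representation of
  the form (4.41), more exactly of the form (5.16) and to find the coefficient β. To prove bounds for the expression in (4.34) connected
  with the remainder in the above representation, it is important to write it explicitly as a higher order polynomial in ∂(p), ∂̄(p)
  with analytic coefficients»*) — the programme: `Hyp` IS «the above properties»; row B12.Eq5.16: cited; ★ `Hyp.taylorData3`.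
* p. 294 l. 1–9 [p0046.txt:L1–L9] (*«We obtain such a representation using some simple expansion connected with the Laurent series
  expansion. It was used already in [43] for a similar purpose … Because of the periodicity properties of the function Π_{μν}(ζ) it
  is natural to choose the variables z_μ = e^{iζ_μ}»*, (5.17) and its unnumbered companion *«Π_{μν}(ζ₁, …, ζ_d) = f_{μν}(e^{iζ₁}, …,
  e^{iζ_d})»*) — row B12.Eq5.17-5.21 (`B12Momentum511.piT_eq_f529`, `expI`): cited.
* p. 294 l. 10–15 [L10–L15] (*«The functions f_{μν}(z) are analytic on the polyring ⨉_μ{e^{−δ₁} < ∣z_μ∣ < e^{δ₁}}, and the properties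
  (5.12)–(5.15) imply the following ones»*, (5.18)–(5.21)) — row B12.Eq5.17-5.21: cited (`B12Rep526Analytic.analyticOnNhd_f529`).
* p. 294 l. 16–31 [L16–L31] (the one-variable splitting paragraph, verbatim in `B12Sec5Algebra`'s header; *«It is unique up to an
  additive constant, and it can be made unique requiring some normalization conditions»*; the three cases) and (5.22)–(5.24) with
  *«the functions g^ε_{μν}(z) are analytic on the polydisc ⨉_μ{∣z_μ∣ < e^{δ₁}}. They satisfy the normalization conditions»* — row
  B12.Eq5.22-5.26: cited; LOCATED READING NOTE on the second member of (5.24) as rendered (fails whenever Π_{μν}(0) ≠ 0; the ν-condition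
  `eq524_nu` is the one that holds): `B12Rep526Coeff.not_eq524_second_member` — cited in that corrected reading, never restated.
* p. 295 l. 1–13 [p0047.txt:L1–L13] (*«These normalization conditions and the transformation laws (5.19) imply the equalities»* (5.25);
  *«Denoting g_{μν}(z) = g^{(+1,…,+1)}_{μν}(z), we get the following representation»* (5.26); *«Let us now write properties of the
  functions g_{μν}(z) equivalent to the properties (5.18)–(5.20). The equalities (5.18) are equivalent to»* (5.27); *«The equalities
  (5.19) are implied by the form of the representation (5.26). The equalities (5.20) are equivalent to»* (5.28)) — rows B12.Eq5.22-5.26,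
  B12.Eq5.27-5.29: cited (`B12Rep526.eq519_of_rep526`, `eq518_of_eq527 ∕ B12Rep526Unique.eq527_of_eq518`, `eq520_of_eq528 ∕
  eq528_of_eq520` are exactly the printed «implied by» ∕ «equivalent to»); `Hyp.eq526`.
* p. 295 l. 14–23 [L14–L23] ((5.29) *«From the definition of the function f_{μν}(z), we have also the following representation»*;
  *«hence the terms of the representation (5.22) are obtained by restricting correspondingly the range of the summation in (5.29). This
  implies that all these terms, and in particular the function g_{μν}(z), are real functions for real variables z. It is possible also
  to write the gauge invariance (5.21) in terms of the functions g_{μν}(z), but it is much simpler to investigate its consequences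
  later on, for simplified representations»*) — row B12.Eq5.27-5.29: cited (`eq529_restricted`, `piece_im_eq_zero`, `gRep_im_eq_zero`);
  the last sentence is a remark.
* p. 295 l. 24–33 [L24–L33] (*«The first step to get (5.16) is to expand the functions g_{μν}(z) up to the third order around the point
  (1, …, 1) = 1»*, (5.30); *«The coefficients a, b and the functions g above are real for real values of z, the functions are analytic
  on the polydisc ⨉_μ{∣z_μ∣ < e^{δ₁}}. Let us investigate the coefficients. The properties (5.27) imply»* (5.31)) — row B12.Eq5.30-5.32:
  cited; LOCATED PRINT SLIP: the remainder weight «(1 − t)» of (5.30) as rendered fails (`B12Taylor530.weight_one_fails`, cell GAPS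
  G-B12-04), the squared weight holds (`weight_two_holds`, `eq530`) — cited in the corrected reading, never restated.
* p. 296 l. 1–6 [p0048.txt:L1–L6] (*«for all permutations r, identically for higher order derivatives, hence»* (5.32); *«This implies
  that all the coefficients a_{μν,κ} with three different indices are equal, similarly all the coefficients a_{μμ,ν} with μ ≠ ν are
  equal, and so on. The same conclusions hold for b_{μν,κλ}»*) — row B12.Eq5.30-5.32: cited (`coeffA_eq_of_distinct`, `coeffA_mixed_eq`,
  `coeffA_diag_eq`, `coeffB_eq_of_perm`).
* p. 296 l. 7–19 [L7–L19] (*«Now we substitute the expansion (5.30) into the representation (5.26). Only the first three terms on the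
  right-hand side of (5.30) may contribute to the basic second order operator in (5.16), the third order terms in (5.30) give rise to
  the higher order terms of the remainder in (5.16). They have also the desired analyticity properties. Some of the lower order terms in
  (5.30) generate higher order terms also. Writing explicitly only the lower order terms, and making simple algebraic transformations,
  we finally get the following representation»* (5.33) *«where the dots denote summation over other possible third order monomials in
  z⁻¹ − 1, z − 1. The coefficients f′ are analytic functions on the polyring in (5.17)»*) — row B12.Eq5.33-5.35: cited; LOCATED PRINT
  SLIP in the third line of (5.33) (the compensating term should read −2b_{μμ,μμ}; harmless downstream): `B12Sec5Algebra.F11_sub_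
  printed533 ∕ printed533_diag_witness ∕ defect_not_third_order` (cell GAPS G-b12g2-1) — cited in the corrected reading, never restated.
* p. 296 l. 20–34 [L20–L34] (the comments: *«For z = 1 we get f_{μν}(1) = δ_{μν}2^d g_{μμ}(1), hence f_{μν}(1) = 0 for μ ≠ ν.
  Differentiating the second identity in (5.21) with respect to z_μ and taking it at the point 1 yields f_{μμ}(1) = 0, hence g_{μμ}(1) =
  0 by the above equality. Thus the whole term in the first line on the right-hand side of (5.33) is equal to 0. Now we investigate
  consequences of the gauge invariance (5.21) … We multiply (5.33) by z_ν − 1, sum over ν, and we obtain an expression identically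
  equal to 0. This expression is an analytic function in a neighborhood of the point 1. Expanding it into a power series we obtain a
  system of equations … We have to consider third order terms only, and the equations are»* (5.34); *«Denoting the left-hand side of
  these equations by −β_{μν}, we have»* (5.35)) — row B12.Eq5.33-5.35: cited (`ward534` = (5.34)₁ verbatim; the printed (5.34)₂
  `ward534_printed` vs the corrected diagonal equation, both holding for the functions at hand by `gdiag_axis_vanishes` — G-b12g2-1;
  `eq535_diag_coeff`).
* p. 296 l. 35–36 [L35–L36] (*«We have discussed already the consequences of the symmetries (5.32). They imply that all the coefficients
  β_{μν} for μ ≠ ν are equal. Denoting the common»* — the sentence ends on p. 297 l. 1 with (5.36), block 26) — row B12.Eq5.33-5.35: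
  cited (`B12Sec5Algebra.eq536_12 ∕ transverse_jet`; in the (1.22) currency `B12Beta.secondMoment_pair_indep`); `Hyp.secondMoment_
  pair_indep`.  BOUNDARY with block 26 (carve-01 g6): (5.36) p. 297 onwards — the common value β, (5.37)–(5.44), the β-function
  properties pp. 298–301 — is NOT typed or bundled here; the corollary `B12Transverse536.rep538_of_symmetries` ((5.37)∕(5.38)∕(5.44)
  from exactly the fields of `Hyp`) is block 26's to cite.

RESULT OF THE CENSUS: NO printed statement of pp. 292–296 lacks an in-tree declaration; the block's residual is EMPTY and this file
types NO new `…Printed` statement.  Three printed displays of the block stand CORRECTED in the tree, by theorems, and are cited in their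
corrected reading, never restated: the second member of (5.24) (`B12Rep526Coeff.not_eq524_second_member`), the remainder weight of
(5.30) (`B12Taylor530.weight_one_fails`, GAPS G-B12-04) and the third line of (5.33) with (5.34)₂ (`B12Sec5Algebra.F11_sub_printed533`,
GAPS G-b12g2-1).

STANDING SMALLNESS (cell lead RULING #9, `carve/STATUS.md` 2026-08-28T07:49:36Z — reading rule for new filings).  [I]'s standing clause is
Theorem 1 p. 259 (the couplings g_k in the interval of (0.33)-type, *«for γ sufficiently small»*) and the inductive hypotheses (1.18)
with the uniform constant E₀.  In THIS file no smallness parameter occurs at all: `Hyp` is a family of PROPERTIES of given kernels with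
the two constants of (5.10) displayed explicitly (`C` = print's «O(1)E₀», `δ₁ > 0` = print's *«positive constant δ₁ determined by δ₀,
κ, and M»*, field `δ₁_pos`), quantified BEFORE the family index as print's uniformity demands; so RULING #9 (2)'s binder `∃ a > 0, ∀ ε,
0 < ε → ε ≤ a → …` has no place to go here (no new `…Printed` statement is typed).  The coupling window enters only in the consumers that
instantiate the family (e.g. `Node00.U3OfKernels.KernelDecay … (Window θ.γ)`, `B12StepObligation.Beta542Source.decay : ∀ g, 0 ≤ g → g ≤
c.γ → …`), where it is displayed.

## What is here
* §1 `Hyp P C δ₁` — ONE `Prop`-valued structure over a FAMILY of vacuum-polarization kernels `P : ι → B12Beta.Kernel d` (one per step ∕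
  coupling history; `B12Beta.Kernel d = Fin d → Fin d → (ℤᵈ → ℝ)`, the (1.21)∕(5.8)₁ translation-invariant real kernel of record) and the
  two constants of (5.10), conjoining BY NAME: `δ₁_pos`, `decay i μ ν : B12Sec2to5.Decay510 (P i μ ν) C δ₁` ((5.10)); `perm i :
  B12Beta.PermCovariant (P i)` ((5.6)∕(5.12)); `refl i : B12Transverse536.ReflCovariant (P i)` ((5.7)∕(5.13)); `symm i :
  Beta.PolarizationSign.IndexSymmetric (P i)` ((5.8)₂∕(5.14)); `ward i : B12Transverse536.WardFirst (P i)` ((5.9)₁∕(5.15)).  Each field is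
  DISCHARGED in the tree from the section's inputs for the kernels of record: (5.6)–(5.8) by `B12EuclCov567.symmetries_of_limit_of_
  invariance` from (5.1)–(5.2), (5.9) by `B12GaugeInv47.eq59_of_limit_of_gaugeInvariance47` from (4.15)₁, (5.10) by `B12Decay510.decay510_
  of_leaves ∕ decay510_of_family` from (4.37) and the inductive bounds — a consumer holding those feeds `hyp_of_parts`.
* §2 kernel-checked bookkeeping out of `Hyp` (no statement asserted): `Hyp.expBound` ((5.10) on the complex carrier, `B12Rep537.expBound_
  of_decay510`); `Hyp.momentSummable` (all polynomial moments, `Beta.PolarizationSign.momentSummable_of_decay510`); `Hyp.secondMoment_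
  abs_le` (*the* §5 output on the numbers (1.22): `∣Σ_x Π_{μν}(x)x_μx_ν∣ ≤ β′(C, δ₁)` uniformly in the family, `B12Sec2to5.secondMoment_
  abs_le_of_decay510 ∕ betaPrime510` — the bound `B12StepObligation.betaBound_of_beta542` consumes); `Hyp.secondMoment_pair_indep`
  (p. 296 *«all the coefficients β_{μν} for μ ≠ ν are equal»* in the (1.22) currency, `B12Beta.secondMoment_pair_indep`);
  `Hyp.secondMoment_comm` ((5.8)₂, `Beta.PolarizationSign.secondMoment_comm`); `Hyp.wardTransversal` (the β sub-cell's spelling of (5.9)₁,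
  definitionally the same clause); `Hyp.analytic511` (p. 293 *«can be extended as an analytic function to … ∣q_μ∣ < δ₁»*,
  `B12Momentum511.analyticOnNhd_piT_of_decay510`); `Hyp.eq512`, `Hyp.eq513` ((5.12), (5.13) from (5.6), (5.7): `B12Momentum511.eq512 ∕
  eq513_of_reflCovariant`); `Hyp.eq526` ((5.26) on every thinner polyring, `B12Rep526Coeff.eq526_of_reflCovariant`); ★ `Hyp.taylorData3`
  (the GOAL (5.16) in its second-order content with β = the second moment (1.22) at any fixed pair μ₀ ≠ ν₀, for EVERY component —
  `B12Transverse536.taylorData3_of_symmetries`: *«using the above properties only»*, kernel-checked); `Hyp.comp` (sub-families);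
  `hyp_of_parts` (the constructor displayed).

## HONEST SCOPE — what is NOT claimed
Nothing of [B12] is proved here and no `…Printed` statement is asserted: `Hyp` is a HYPOTHESIS bundle on abstract kernels; the theorems
are bookkeeping into the siblings' kernel-checked results (which are theorems about ANY kernel with these properties).  That Bałaban's
tensor Π^{(j)} of (4.37)∕(5.1) HAS these properties with constants uniform in j is exactly what the bundle assumes: print derives
(5.6)–(5.9) from the invariances (5.2)∕(4.15) (in tree for the limit kernels, cited above) and asserts (5.10) from *«the representation
(4.37)»* in one word (cell GAPS G-B12s-15, G-pv13-4 (1); the tree's `B12Decay510*` derive it from displayed leaves).  Nothing is said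
about the SIGN or SIZE of β (block 26; cell GAPS G1 ∕ G-adv2-3; `Dag.Leaves.betaPositive` untouched), nothing about g-regularity of
β_j (G-b12-2 (ii)).  No summit statement is proved by this seat; K2⁷ is NOT discharged; the file moves no node count; one lattice paper's
§5 — nothing continuum ∕ ℝ⁴ ∕ OS ∕ mass-gap ∕ Clay.  No `sorry`, no `instance`, no `notation`, no attribute manipulation; imports
`…B12Momentum511` (hence `…B12Rep526Coeff`, `…B12Transverse536`, `…B12Rep537`, `…B12Sec2to5`, `…B12Beta`) and `…Beta.PolarizationSign` only.
-/

namespace Literature.MathematicalPhysics.QuantumFieldTheory.Balaban1983to89.B12Carve25Sect5TensorHyp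

open _root_.Literature.MathematicalPhysics.QuantumFieldTheory.GawedzkiKupiainen1985.PeriodicGleason (Pt PolyAnnulus ExpBound)

/-! ## §1 The block-25 hypothesis bundle -/

/-- **BLOCK 25 OF [B12] — SECT. 5, PART 1 — AS ONE HYPOTHESIS BUNDLE** (pp. 292–296 [PDF 44–48]) over a family `P i` (`i : ι`, one
kernel per step ∕ coupling history — p. 298: *«we should write the superscript (j) at the tensor»*) of vacuum-polarization kernels in
the (1.21)∕(5.8)₁ currency `B12Beta.Kernel d` (*«The function Π is also translation invariant»* — the type), with the two constants of
(5.10) BEFORE the family index: the section's standing properties, p. 293 after (5.15) verbatim *«We will analyze this function using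
the above properties only»*, conjoined BY NAME —
`decay` = **(5.10) p. 293** verbatim: *«The representation (4.37) yields the following inequality ∣Π_{μν}(x − y)∣ ≦ O(1)E₀ exp(−δ₁∣x −
y∣), (5.10) with a positive constant δ₁ determined by δ₀, κ, and M (e.g., δ₁ = ½min{δ₀, κM⁻¹})»* (`B12Sec2to5.Decay510`, ℓ¹ distance;
`C` = O(1)E₀; `δ₁_pos`);
`perm` = **(5.6) p. 292** verbatim: *«If r is a transformation defined by a permutation π: (rx)_μ = x_{π⁻¹(μ)}, then the equality (5.4)
can be written as Π_{μν}(rx, ry) = Π_{π⁻¹(μ),π⁻¹(ν)}(x, y) = ((r⊗r)Π)_{μν}(x, y)»* (`B12Beta.PermCovariant`, the (1.21) typing;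
dictionary `B12Covariance54.permCovariant_iff`);
`refl` = **(5.7) p. 293** verbatim: *«Π_{μν}(εx − ((1−ε_μ)∕2)e_μ, εy − ((1−ε_ν)∕2)e_ν) = ε_με_νΠ_{μν}(x, y)»* (single-axis reflections,
difference variable: `B12Transverse536.ReflCovariant`; dictionary `B12Covariance54.reflCovariant_iff`);
`symm` = **(5.8) p. 293**, second identity, verbatim: *«Π_{μν}(x) = Π_{νμ}(−x)»* (`Beta.PolarizationSign.IndexSymmetric`);
`ward` = **(5.9) p. 293**, first identity, verbatim: *«The gauge invariance, expressed in the first identity (4.15), implies Σ_μ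
∂*_μΠ_{μν}(x − y) = … = 0»* (`B12Transverse536.WardFirst`; the second identity follows under (5.8) and takes no slot).
Hypothesis slot only; nothing asserted.  The displays (5.1)–(5.5) (definition and two-point covariance), (5.11)–(5.35) (momentum
representation, Laurent splitting, Taylor jets) are PROVED ∕ BODIED in the sibling modules of the module docstring's table, mostly as
theorems about any kernel with these properties, and take no slot. [cite: Balaban1987RG1, (5.6)-(5.10) pp.292-293 with p.293 ("using the above properties only")] -/
structure Hyp {ι : Type*} {d : ℕ} (P : ι → B12Beta.Kernel d) (C δ₁ : ℝ) : Prop where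
  /-- (5.10) p. 293: *«with a positive constant δ₁»*. -/
  δ₁_pos : 0 < δ₁
  /-- (5.10) p. 293 — in tree: `B12Sec2to5.Decay510`, every component, constants uniform in the family. -/
  decay : ∀ (i : ι) (μ ν : Fin d), B12Sec2to5.Decay510 (P i μ ν) C δ₁
  /-- (5.6) p. 292 ∕ (5.12) p. 293 — in tree: `B12Beta.PermCovariant`. -/
  perm : ∀ i : ι, B12Beta.PermCovariant (P i)
  /-- (5.7) ∕ (5.13) p. 293 — in tree: `B12Transverse536.ReflCovariant`. -/
  refl : ∀ i : ι, B12Transverse536.ReflCovariant (P i)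
  /-- (5.8) p. 293, second identity ∕ (5.14) — in tree: `Beta.PolarizationSign.IndexSymmetric`. -/
  symm : ∀ i : ι, Beta.PolarizationSign.IndexSymmetric (P i)
  /-- (5.9) p. 293, first identity ∕ (5.15) — in tree: `B12Transverse536.WardFirst`. -/
  ward : ∀ i : ι, B12Transverse536.WardFirst (P i)

/-! ## §2 Bookkeeping (kernel-checked uses of the cited declarations; no statement asserted) -/

section Proj

variable {ι : Type*} {d : ℕ} {P : ι → B12Beta.Kernel d} {C δ₁ : ℝ}

/-- **Sub-families**: the bundle restricts along any re-indexing `f : κ → ι` (e.g. to the kernels of one window of couplings).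
[cite: Balaban1987RG1, (5.6)-(5.10) pp.292-293 (bookkeeping)] -/
theorem Hyp.comp {κ : Type*} (h : Hyp P C δ₁) (f : κ → ι) : Hyp (fun k => P (f k)) C δ₁ :=
  ⟨h.δ₁_pos, fun k => h.decay (f k), fun k => h.perm (f k), fun k => h.refl (f k), fun k => h.symm (f k),
    fun k => h.ward (f k)⟩

/-- **(5.10) on the complex carrier**: every component, read in `ℂ`, is `ExpBound δ₁ C` — the form the momentum-side modules consume
(`B12Rep537.expBound_of_decay510`). [cite: Balaban1987RG1, (5.10) p.293 (bookkeeping)] -/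
theorem Hyp.expBound (h : Hyp P C δ₁) (i : ι) (μ ν : Fin d) :
    ExpBound δ₁ C (B12Rep537.ofReal (P i μ ν)) :=
  B12Rep537.expBound_of_decay510 (h.decay i μ ν)

/-- **(5.10) ⇒ all polynomial moments converge** (the summability behind (1.22)∕(5.42) and every moment identity of §5), by
`Beta.PolarizationSign.momentSummable_of_decay510`. [cite: Balaban1987RG1, (5.10) p.293 (bookkeeping)] -/
theorem Hyp.momentSummable (h : Hyp P C δ₁) (i : ι) (n : ℕ) :
    Beta.PolarizationSign.MomentSummable (P i) n :=
  Beta.PolarizationSign.momentSummable_of_decay510 h.δ₁_pos (h.decay i) n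

/-- **What (5.10) yields on the numbers (1.22)** — p. 264 *«uniformly bounded on this interval»* as far as §5 proves it: for every
member of the family and every pair of directions `∣Σ_x Π_{μν}(x) x_μ x_ν∣ ≤ β′(C, δ₁) = C·Σ_x ∣x∣₁² e^{−δ₁∣x∣₁}`, ONE bound for the
whole family (`B12Sec2to5.secondMoment_abs_le_of_decay510`, `betaPrime510`; this is the input `le_beta'`∕`decay` of
`B12StepObligation.Beta542Source` feeds `betaBound_of_beta542`).  The identification of this number with β_{j} is (5.42) p. 297 —
block 26, not used here. [cite: Balaban1987RG1, (5.10) p.293 with (1.22) p.264 (bookkeeping)] -/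
theorem Hyp.secondMoment_abs_le (h : Hyp P C δ₁) (i : ι) (μ ν : Fin d) :
    |B12Beta.secondMoment (P i) μ ν| ≤ B12Sec2to5.betaPrime510 d C δ₁ :=
  (B12Sec2to5.secondMoment_abs_le_of_decay510 h.δ₁_pos (h.decay i μ ν)).2

/-- **p. 296 l. 35–36: «all the coefficients β_{μν} for μ ≠ ν are equal»** — in the (1.22) currency and from (5.6) alone: the second
moment is the same number at every off-diagonal pair (`B12Beta.secondMoment_pair_indep`, a re-indexing of the lattice sum; no
summability needed). [cite: Balaban1987RG1, p.296 (after (5.35)) with (5.32) and (1.22) p.264 (bookkeeping)] -/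
theorem Hyp.secondMoment_pair_indep (h : Hyp P C δ₁) (i : ι) {μ ν μ' ν' : Fin d} (hμν : μ ≠ ν) (hμν' : μ' ≠ ν') :
    B12Beta.secondMoment (P i) μ' ν' = B12Beta.secondMoment (P i) μ ν :=
  B12Beta.secondMoment_pair_indep (h.perm i) hμν hμν'

/-- **(5.8)₂ on the numbers (1.22)**: the second moment is symmetric in the pair of directions
(`Beta.PolarizationSign.secondMoment_comm`). [cite: Balaban1987RG1, (5.8) p.293 with (1.22) p.264 (bookkeeping)] -/
theorem Hyp.secondMoment_comm (h : Hyp P C δ₁) (i : ι) (μ ν : Fin d) :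
    B12Beta.secondMoment (P i) μ ν = B12Beta.secondMoment (P i) ν μ :=
  Beta.PolarizationSign.secondMoment_comm (h.symm i) μ ν

/-- **(5.9)₁ in the β sub-cell's spelling** (`Beta.PolarizationSign.WardTransversal`, the hypothesis of its sign ∕ second-moment
theorems): the same clause as `B12Transverse536.WardFirst` — both read `Σ_μ (Π_{μν}(z − e_μ) − Π_{μν}(z)) = 0` with the unit lattice
vectors `e_μ` (`B6BondElimination.unitVec` ∕ `PeriodicGleason.unitVec`, the same function). [cite: Balaban1987RG1, (5.9) p.293 (bookkeeping)] -/
theorem Hyp.wardTransversal (h : Hyp P C δ₁) (i : ι) : Beta.PolarizationSign.WardTransversal (P i) :=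
  h.ward i

/-- **p. 293 after (5.11): «By the inequality (5.10) it can be extended as an analytic function to complex variables ζ_μ = p_μ + iq_μ,
∣q_μ∣ < δ₁»** — every component's momentum representation `Π̃_{μν}(ζ) = Σ_x e^{−iζ·x}Π_{μν}(x)` (`B12Momentum511.piT`) is analytic on the
open polystrip `⨉_μ{∣Im ζ_μ∣ < δ₁}` (`B12Momentum511.analyticOnNhd_piT_of_decay510`). [cite: Balaban1987RG1, (5.11) p.293 (bookkeeping)] -/
theorem Hyp.analytic511 (h : Hyp P C δ₁) (i : ι) (μ ν : Fin d) :
    AnalyticOnNhd ℂ (B12Momentum511.piT (B12Rep537.ofReal (P i μ ν))) (B12Momentum511.PolyStrip d δ₁) :=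
  B12Momentum511.analyticOnNhd_piT_of_decay510 (h.decay i μ ν)

/-- **(5.12) p. 293: «Π_{μν}(rζ) = ((r⊗r)Π)_{μν}(ζ) if r is a permutation»** — for every member, from (5.6) (`B12Rep526Coeff.perm512_of_
permCovariant`, `B12Momentum511.eq512`; `(rζ)_μ = ζ_{r⁻¹μ}` = `B12Rep526.permZ`). [cite: Balaban1987RG1, (5.12) p.293 (bookkeeping)] -/
theorem Hyp.eq512 (h : Hyp P C δ₁) (i : ι) (r : Equiv.Perm (Fin d)) (μ ν : Fin d) (ζ : Fin d → ℂ) :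
    B12Momentum511.piT (B12Rep526Coeff.castK (P i) μ ν) (B12Rep526.permZ r ζ)
      = B12Momentum511.piT (B12Rep526Coeff.castK (P i) (r.symm μ) (r.symm ν)) ζ :=
  B12Momentum511.eq512 (B12Rep526Coeff.castK (P i)) (B12Rep526Coeff.perm512_of_permCovariant (h.perm i)) r μ ν ζ

/-- **(5.13) p. 293: «Π_{μν}(εζ) = ε_με_ν exp(−i((1−ε_μ)∕2)ζ_μ) exp(i((1−ε_ν)∕2)ζ_ν) Π_{μν}(ζ)»** — for every member and every sign
vector ε, from (5.7) (`B12Momentum511.eq513_of_reflCovariant`). [cite: Balaban1987RG1, (5.13) p.293 (bookkeeping)] -/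
theorem Hyp.eq513 (h : Hyp P C δ₁) (i : ι) (μ ν : Fin d) (ε : Fin d → ℤˣ) (ζ : Fin d → ℂ) :
    B12Momentum511.piT (B12Rep526Coeff.castK (P i) μ ν) (fun κ => ((ε κ : ℤ) : ℂ) * ζ κ)
      = B12Rep526.sgn (ε μ) * B12Rep526.sgn (ε ν)
          * (Complex.exp (-(Complex.I * ((1 - ((ε μ : ℤ) : ℂ)) / 2 * ζ μ)))
              * Complex.exp (Complex.I * ((1 - ((ε ν : ℤ) : ℂ)) / 2 * ζ ν)))
          * B12Momentum511.piT (B12Rep526Coeff.castK (P i) μ ν) ζ :=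
  B12Momentum511.eq513_of_reflCovariant (h.refl i) μ ν ε ζ

/-- **(5.26) p. 295: «f_{μν}(z) = Σ_ε ε_με_ν z_μ^{(1−ε_μ)∕2} z_ν^{−(1−ε_ν)∕2} g_{μν}(z^ε)»** — for every member, on every polyring
`⨉_μ{e^{−b} < ∣z_μ∣ < e^{b}}`, `b < δ₁`, with the normalized Laurent pieces `g_{μν}` of (5.22)–(5.25) (`B12Rep526Coeff.gRep`) and
`f_{μν}` of (5.17)∕(5.29) (`f529`): from (5.7) and (5.10) (`B12Rep526Coeff.eq526_of_reflCovariant`).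
[cite: Balaban1987RG1, (5.26) p.295 with (5.17), (5.22)-(5.25) p.294 (bookkeeping)] -/
theorem Hyp.eq526 (h : Hyp P C δ₁) (i : ι) (μ ν : Fin d) {b : ℝ} (hb : b < δ₁) {z : Fin d → ℂ} (hz : z ∈ PolyAnnulus d b) :
    B12Rep526Coeff.f529 (B12Rep526Coeff.castK (P i)) μ ν z
      = B12Rep526.rep526 (B12Rep526Coeff.gRep (B12Rep526Coeff.castK (P i))) μ ν z :=
  B12Rep526Coeff.eq526_of_reflCovariant (h.refl i) (h.expBound i μ ν) hb hz

/-- ★ **THE SECTION'S GOAL (5.16) p. 293, second-order content, for every member and EVERY component** — verbatim: *«Our goal is to prove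
a representation of the form (4.41), more exactly of the form Π_{μν}(p) = β(δ_{μν}Δ(p) − ∂̄_μ(p)∂_ν(p)) + (terms of higher orders in
derivatives ∂(p), ∂̄(p)), (5.16) and to find the coefficient β»*: all moments of order < 3 of `Π_{μν}` are `β ×` those of the Wilson
quadratic form `Q_{μν}` (`B12Rep537.TaylorData3`, `wilsonQ`), with `β` = the second moment (1.22) at any fixed off-diagonal pair
`μ₀ ≠ ν₀` — *«using the above properties only»*: `B12Transverse536.taylorData3_of_symmetries` ((5.6) + (5.7) + (5.9)₁ + (5.10);
(5.8)₂ is not needed).  The passage to (5.36)–(5.38)∕(5.44) with the remainder bound (`B12Transverse536.rep538_of_symmetries`,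
`B12Rep537.rep538_of_decay510`) is p. 297 = block 26 and is only cited. [cite: Balaban1987RG1, (5.16) p.293 with p.293 l.30 (bookkeeping)] -/
theorem Hyp.taylorData3 (h : Hyp P C δ₁) (i : ι) {μ₀ ν₀ : Fin d} (h0 : μ₀ ≠ ν₀) (μ ν : Fin d) :
    B12Rep537.TaylorData3 ((B12Beta.secondMoment (P i) μ₀ ν₀ : ℝ) : ℂ) μ ν (B12Rep537.ofReal (P i μ ν)) :=
  B12Transverse536.taylorData3_of_symmetries h.δ₁_pos (h.decay i) (h.perm i) (h.refl i) (h.ward i) h0 μ ν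

end Proj

/-- **The bundle from its named parts** (the constructor, displayed for consumers who obtain the five properties separately — e.g. from
`B12EuclCov567.symmetries_of_limit_of_invariance` ((5.6)–(5.8) from (5.1)–(5.2)), `B12GaugeInv47.eq59_of_limit_of_gaugeInvariance47`
((5.9) from (4.15)₁) and `B12Decay510.decay510_of_leaves` ((5.10) from (4.37))). [cite: Balaban1987RG1, (5.6)-(5.10) pp.292-293 (bookkeeping)] -/
theorem hyp_of_parts {ι : Type*} {d : ℕ} (P : ι → B12Beta.Kernel d) {C δ₁ : ℝ} (hδ : 0 < δ₁)
    (h510 : ∀ (i : ι) (μ ν : Fin d), B12Sec2to5.Decay510 (P i μ ν) C δ₁)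
    (h56 : ∀ i : ι, B12Beta.PermCovariant (P i)) (h57 : ∀ i : ι, B12Transverse536.ReflCovariant (P i))
    (h58 : ∀ i : ι, Beta.PolarizationSign.IndexSymmetric (P i)) (h59 : ∀ i : ι, B12Transverse536.WardFirst (P i)) :
    Hyp P C δ₁ :=
  ⟨hδ, h510, h56, h57, h58, h59⟩

end Literature.MathematicalPhysics.QuantumFieldTheory.Balaban1983to89.B12Carve25Sect5TensorHyp
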